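import Mathlib

/-!
# Symmetric lacunary pencils — three library lemmas (Mathlib only)

Home of `le_card_posRoots_of_alternating`, `eval_det_pencil`, `card_filter_roots_det_sum_fin_zero`, MOVED VERBATIM
(same namespace, FQNs unchanged) from `Theorems/SymmetroidDescartesRolleToDescartes.lean` (l.51–118 there) by the
cell `pub-symmetroid` import refactor (HOME/IMPORT-REFACTOR-PLAN.md v1, 2026-08-26): that file imports the retired route
`Theses.SymmetroidDescartes` for its record definitions, while these three lemmas are used by ≈ 100 census modules that
need no route file.  Build hygiene only; no statement changed. [folklore]
-/

-- `Summit.ValiantsHypothesis.ValiantsHypothesis.…` is the tree's mandated single-conjunct layout (Sub = Summit).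
set_option linter.dupNamespace false

namespace Summit.ValiantsHypothesis.ValiantsHypothesis.Theorems.SymmetroidDescartes

open scoped BigOperators Topology Classical Matrix Polynomial
open Filter

/-! ### 1. Sign alternations give distinct positive roots -/

/-- If a real polynomial `p` satisfies `p(τ j) · p(τ (j+1)) < 0` along a strictly increasing positive
sequence `τ 0 < … < τ N`, then `p` has at least `N` distinct positive roots (one in each gap, by the
intermediate value theorem). [folklore] -/
theorem le_card_posRoots_of_alternating (p : ℝ[X]) (N : ℕ) (τ : Fin (N + 1) → ℝ)
    (hτ : StrictMono τ) (hpos : ∀ j, 0 < τ j)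
    (halt : ∀ j : Fin N, p.eval (τ j.castSucc) * p.eval (τ j.succ) < 0) :
    N ≤ (p.roots.toFinset.filter (fun t => 0 < t)).card := by
  have hroot : ∀ j : Fin N, ∃ r, τ j.castSucc < r ∧ r < τ j.succ ∧ p.IsRoot r := by
    intro j
    have hlt : τ j.castSucc < τ j.succ := hτ (by exact Fin.castSucc_lt_succ)
    have hcont : ContinuousOn (fun x => p.eval x) (Set.Icc (τ j.castSucc) (τ j.succ)) :=
      p.continuous.continuousOn
    rcases mul_neg_iff.1 (halt j) with ⟨h1, h2⟩ | ⟨h1, h2⟩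
    · obtain ⟨r, ⟨hr1, hr2⟩, hr⟩ := intermediate_value_Ioo' hlt.le hcont ⟨h2, h1⟩
      exact ⟨r, hr1, hr2, hr⟩
    · obtain ⟨r, ⟨hr1, hr2⟩, hr⟩ := intermediate_value_Ioo hlt.le hcont ⟨h1, h2⟩
      exact ⟨r, hr1, hr2, hr⟩
  choose r hr₁ hr₂ hr₃ using hroot
  have hmono : StrictMono r := by
    intro i j hij
    have hij' : (i : ℕ) < j := hij
    calc r i < τ i.succ := hr₂ i
      _ ≤ τ j.castSucc := hτ.monotone (by
          rw [Fin.le_def, Fin.val_succ, Fin.val_castSucc]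
          exact hij')
      _ < r j := hr₁ j
  calc N = (Finset.univ : Finset (Fin N)).card := by simp
    _ ≤ (p.roots.toFinset.filter (fun t => 0 < t)).card := by
      refine Finset.card_le_card_of_injOn r (fun j _ => ?_) hmono.injective.injOn
      have hp : p ≠ 0 := by
        rintro rfl
        exact (lt_irrefl (0 : ℝ)) (by simpa using halt j)
      simp only [Finset.mem_coe, Finset.mem_filter, Multiset.mem_toFinset, Polynomial.mem_roots hp]
      exact ⟨hr₃ j, (hpos _).trans (hr₁ j)⟩

/-! ### 2. Evaluating pencil determinants; the empty pencil -/

/-- Evaluating the determinant of the polynomial pencil `∑ X^(d l) • S l` at a real point `t` gives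
the determinant of the real matrix `∑ t^(d l) • S l` (`det` commutes with the evaluation ring
homomorphism). [folklore] -/
theorem eval_det_pencil {ι : Type*} [Fintype ι] {m : ℕ} (S : ι → Matrix (Fin m) (Fin m) ℝ)
    (d : ι → ℕ) (t : ℝ) :
    ((∑ l, (Polynomial.X : ℝ[X]) ^ d l • (S l).map Polynomial.C).det).eval t
      = (∑ l, t ^ d l • S l).det := by
  have h := RingHom.map_det (Polynomial.evalRingHom t)
    (∑ l, (Polynomial.X : ℝ[X]) ^ d l • (S l).map Polynomial.C)
  rw [Polynomial.coe_evalRingHom] at h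
  rw [h, map_sum]
  congr 1
  refine Finset.sum_congr rfl fun l _ => ?_
  ext i j
  simp [Matrix.smul_apply]
  exact mul_comm _ _

/-- A sum over `Fin 0` of polynomial matrices is the zero matrix, whose determinant (`0` or `1`) has
no roots at all; in particular no positive ones. [folklore] -/
theorem card_filter_roots_det_sum_fin_zero {m : ℕ} (F : Fin 0 → Matrix (Fin m) (Fin m) ℝ[X])
    (q : ℝ → Prop) [DecidablePred q] :
    ((∑ l, F l).det.roots.toFinset.filter q).card = 0 := by
  rw [Finset.card_eq_zero, Finset.filter_eq_empty_iff]
  intro t ht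
  rcases Nat.eq_zero_or_pos m with hm | hm
  · subst hm
    simp [Matrix.det_isEmpty] at ht
  · haveI : Nonempty (Fin m) := Fin.pos_iff_nonempty.1 hm
    simp at ht

end Summit.ValiantsHypothesis.ValiantsHypothesis.Theorems.SymmetroidDescartes
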